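import Literature.Probability.RandomPlanarGeometry.SLETraceShift
import Literature.Probability.RandomPlanarGeometry.SLETransienceZeroOne
import Literature.Probability.RandomPlanarGeometry.SLETraceEight
import Literature.Probability.RandomPlanarGeometry.CritPercSLESimplePath
import HarnessLib

/-!
# The Markov property of the SLE trace at a fixed time

Trunk T-STOCH. Rohde–Schramm, *Basic properties of SLE*, Ann. of Math. 161 (2005), proof of
Thm. 7.1, p. 911: "Note that `g₁(γ[1, ∞))` has the same distribution as `γ[0, ∞)` translated by
`ξ(1)`"; Lawler, *Conformally Invariant Processes in the Plane* (2005), §6.2, p. 148: "For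
every `s ≥ 0`, let `γˢ` denote the curve `γˢ(t) = gₛ(γ(t + s)) - √κ Bₛ`. Note that the
distribution of `γˢ` is the same as that of `γ`." We **prove** this conformal Markov property
of the chordal SLE_κ trace at a fixed time `s`, in three parts.

* *Deterministic identification* (`Loewner.IsGeneratedByCurve.apply_add_eq_extendFrom`, every
  continuous driving function): if the chain of `W` is generated by `γ` and the chain of the
  increments `V = W(s + ·) - W(s)` is generated by `γˢ`, then
  `γ(s + u) = Fₛ(γˢ(u) + W(s))` for all `u`, where `Fₛ` is the continuous extension of
  `fₛ = gₛ⁻¹` to the closed half-plane (`IsGeneratedByCurve.continuousOn_extendFrom_loewnerInv`,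
  `SLETraceEight.lean`). (The tips are boundary limits, `IsGeneratedByCurve.tendsto_invFunOn_map_seq`;
  `f_{s+u} = fₛ ∘ f^{W(s+·)}_u`, `Loewner.loewnerInv_shift`; translation covariance
  `Loewner.loewnerInv_add_const`.) The hypothesis on the shifted chain is necessary: that it is
  generated by a curve does *not* follow deterministically from the same property of the chain
  of `W` (a curve passing through a boundary point of `Hₛ` with several accesses may switch
  access), which is why the stochastic input below is phrased with it.
* *Law* (`identDistrib_trace_shift`): on the canonical space, the trace of the shifted driving
  function `u ↦ W(s + u) - W(s)`, `W = √κ B`, has the law of the SLE_κ trace (weak Markov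
  property of Brownian motion, `identDistrib_sleDriving_shift`, pushed through the measurable
  trace functional `Loewner.exists_measurable_eq_trace`).
* *Independence* (`indepFun_trace_shift`): that trace is independent of `(B t)_{t ≤ s}` (Mathlib
  `IsPreBrownianReal.indepFun_shift`).

The almost sure existence of the shifted trace is the hypothesis `hs` of these statements; it is
supplied for `κ ≠ 0, 8` by Rohde–Schramm's Cor. 3.5 (`ae_exists_isGeneratedByCurve_shift_of_cor35`,
`SLETraceShift.lean`), giving the `_of_cor35` forms, e.g. `sleTrace_add_eq_extendFrom_of_cor35`:
a.s., for all rational `s` and all `u`, `γ(s + u) = Fₛ(γˢ(u) + W(s))` with `γˢ` the trace of the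
increments after `s`.

## References

* S. Rohde, O. Schramm, *Basic properties of SLE*, Ann. of Math. 161 (2005): Prop. 2.1 (ii),
  §7 p. 911 (proof of Thm. 7.1), proof of Lemma 7.3 (p. 910).
* G. F. Lawler, *Conformally Invariant Processes in the Plane*, AMS (2005), §6.2 p. 148 (the
  curves `γˢ`), Prop. 4.31.
-/

noncomputable section

open Set Filter Topology MeasureTheory ProbabilityTheory Complex
open UpperHalfPlane (upperHalfPlaneSet isOpen_upperHalfPlaneSet)
open scoped NNReal

namespace Literature.Probability.RandomPlanarGeometry

/-! ### Deterministic identification of the shifted trace -/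

namespace Loewner

variable {W : ℝ≥0 → ℝ} {γ γs : ℝ≥0 → ℂ}

/-- **`γ(s + u) = Fₛ(γˢ(u) + W(s))`.** Let the chain of the continuous driving function `W` be
generated by `γ`, and the chain of the increments `u ↦ W(s + u) - W(s)` by `γˢ`. Then for every
`u`, `γ(s + u)` is the value at `γˢ(u) + W(s)` of the continuous extension `Fₛ` of `fₛ = gₛ⁻¹` to
the closed half-plane. Proof: `γ(s+u) = limₙ f_{s+u}(W(s+u) + i/(n+1))` and
`gₛ(f_{s+u}(W(s+u) + iy)) = f^{W(s+·)-W(s)}_u(· + iy) + W(s) → γˢ(u) + W(s)`; apply `fₛ` and its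
continuity up to the boundary. Lawler (2005), §6.2 (`γˢ(t) = gₛ(γ(t+s)) - √κ Bₛ`); Rohde–Schramm
(2005), p. 911. [cite: Lawler2005, §6.2] -/
theorem IsGeneratedByCurve.apply_add_eq_extendFrom (hγ : IsGeneratedByCurve W γ) (hW : Continuous W)
    {s : ℝ≥0} (hγs : IsGeneratedByCurve (fun u ↦ W (s + u) - W s) γs) (u : ℝ≥0) :
    γ (s + u) = extendFrom upperHalfPlaneSet (loewnerInv W s) (γs u + W s) := by
  set V : ℝ≥0 → ℝ := fun u ↦ W (s + u) - W s with hV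
  have hVc : Continuous V := (continuous_shift W hW s).sub continuous_const
  have hypos : ∀ n : ℕ, (0 : ℝ) < (1 : ℝ) / (n + 1) := fun n ↦ by positivity
  have him : ∀ (x : ℝ) (n : ℕ), 0 < ((x : ℂ) + I * ((1 : ℝ) / (n + 1) : ℝ)).im := fun x n ↦ by
    simp only [Complex.add_im, Complex.ofReal_im, Complex.mul_im, Complex.I_re, Complex.I_im,
      Complex.ofReal_re, zero_mul, one_mul, zero_add]
    exact hypos n
  -- `z n = f_{s+u}(W(s+u) + i/(n+1)) → γ(s+u)`
  set z : ℕ → ℂ := fun n ↦ loewnerInv W (s + u) ((W (s + u) : ℂ) + I * ((1 : ℝ) / (n + 1) : ℝ))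
    with hz_def
  have hz : Tendsto z atTop (𝓝 (γ (s + u))) := hγ.tendsto_invFunOn_map_seq hW (s + u)
  have hz_dom : ∀ n, z n ∈ domain W s := fun n ↦
    domain_antitone W (le_self_add : s ≤ s + u) (loewnerInv_mem_domain hW (s + u) (him _ n))
  -- `w n = gₛ(z n) = f^V_u(V u + i/(n+1)) + W s → γˢ(u) + W s`
  set w : ℕ → ℂ := fun n ↦ map W s (z n) with hw_def
  have hwV : ∀ n, w n = loewnerInv V u ((V u : ℂ) + I * ((1 : ℝ) / (n + 1) : ℝ)) + W s := by
    intro n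
    have h1 := loewnerInv_add_const hVc (W s) u (z := (V u : ℂ) + I * ((1 : ℝ) / (n + 1) : ℝ))
      (him _ n)
    have h2 : (fun v ↦ V v + W s) = fun v ↦ W (s + v) := funext fun v ↦ by simp [hV]
    have h3 : ((V u : ℂ) + I * ((1 : ℝ) / (n + 1) : ℝ)) + (W s : ℂ) =
        (W (s + u) : ℂ) + I * ((1 : ℝ) / (n + 1) : ℝ) := by
      simp only [hV]
      push_cast
      ring
    rw [h2, h3, loewnerInv_shift hW s u (him _ n)] at h1
    exact h1
  have hw : Tendsto w atTop (𝓝 (γs u + W s)) := by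
    have ht := (hγs.tendsto_invFunOn_map_seq hVc u).add_const ((W s : ℝ) : ℂ)
    exact ht.congr fun n ↦ (hwV n).symm
  have hwH : ∀ n, w n ∈ upperHalfPlaneSet := fun n ↦ mapsTo_map hW s (hz_dom n)
  have hfw : ∀ n, loewnerInv W s (w n) = z n := fun n ↦ loewnerInv_map hW (hz_dom n)
  -- continuity of `Fₛ` at the boundary point
  set F := extendFrom upperHalfPlaneSet (loewnerInv W s) with hF_def
  have hp : γs u + (W s : ℂ) ∈ closure upperHalfPlaneSet :=
    mem_closure_of_tendsto hw (Eventually.of_forall hwH)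
  have hFc : ContinuousWithinAt F (closure upperHalfPlaneSet) (γs u + W s) :=
    hγ.continuousOn_extendFrom_loewnerInv hW s _ hp
  have hF : Tendsto (fun n ↦ F (w n)) atTop (𝓝 (F (γs u + W s))) :=
    hFc.tendsto.comp (tendsto_nhdsWithin_iff.2 ⟨hw, Eventually.of_forall fun n ↦ subset_closure (hwH n)⟩)
  have hF' : Tendsto (fun n ↦ F (w n)) atTop (𝓝 (γ (s + u))) := by
    refine hz.congr fun n ↦ ?_
    rw [hF_def, extendFrom_loewnerInv_eq hW s (hwH n), hfw n]
  exact tendsto_nhds_unique hF' hF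

/-- The curve after time `s` is the image of the shifted trace: `γ[s, ∞) = Fₛ(γˢ[0, ∞) + W(s))`.
[cite: Lawler2005, §6.2] -/
theorem IsGeneratedByCurve.image_Ici_eq_of_shift (hγ : IsGeneratedByCurve W γ) (hW : Continuous W)
    {s : ℝ≥0} (hγs : IsGeneratedByCurve (fun u ↦ W (s + u) - W s) γs) :
    γ '' Ici s = extendFrom upperHalfPlaneSet (loewnerInv W s) '' ((fun z ↦ z + (W s : ℂ)) '' range γs) := by
  ext x
  constructor
  · rintro ⟨t, ht, rfl⟩
    refine ⟨γs (t - s) + W s, ⟨γs (t - s), ⟨t - s, rfl⟩, rfl⟩, ?_⟩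
    rw [← hγ.apply_add_eq_extendFrom hW hγs (t - s), add_tsub_cancel_of_le (mem_Ici.1 ht)]
  · rintro ⟨_, ⟨_, ⟨u, rfl⟩, rfl⟩, rfl⟩
    exact ⟨s + u, mem_Ici.2 le_self_add, hγ.apply_add_eq_extendFrom hW hγs u⟩

end Loewner

/-! ### Law and independence of the shifted trace (canonical space) -/

section Markov

variable {κ : ℝ≥0}

/-- **The shifted trace has the law of the trace.** If SLE_κ is a.s. generated by a curve
(`HasSLETrace κ`) and so is, a.s., the chain of the increments `u ↦ W(s + u) - W(s)` of the
driving function `W = √κ B` (hypothesis `hs`; `ae_exists_isGeneratedByCurve_shift_of_cor35`), then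
the trace of the latter has the law of `sleTrace κ` on the path space `ℝ≥0 → ℂ`. Weak Markov
property of Brownian motion (`identDistrib_sleDriving_shift`) pushed through the measurable
trace functional (`Loewner.exists_measurable_eq_trace`). Rohde–Schramm (2005), Prop. 2.1 (ii)
and p. 911; Lawler (2005), §6.2. [cite: RohdeSchramm2005, Prop. 2.1] -/
theorem identDistrib_trace_shift (h0 : HasSLETrace κ) {s : ℝ≥0}
    (hs : ∀ᵐ ω ∂Process.preWienerMeasure,
      ∃ γ, Loewner.IsGeneratedByCurve (fun u ↦ sleDriving κ ω (s + u) - sleDriving κ ω s) γ) :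
    IdentDistrib (fun ω ↦ Loewner.trace (fun u ↦ sleDriving κ ω (s + u) - sleDriving κ ω s))
      (fun ω ↦ sleTrace κ ω) Process.preWienerMeasure Process.preWienerMeasure := by
  obtain ⟨T, hTm, hT⟩ := Loewner.exists_measurable_eq_trace
  have hmeas : Measurable fun (ω : ℝ≥0 → ℝ) (u : ℝ≥0) ↦ sleDriving κ ω (s + u) - sleDriving κ ω s :=
    measurable_pi_lambda _ fun u ↦ (measurable_sleDriving κ _).sub (measurable_sleDriving κ _)
  have hlaw : IdentDistrib (T ∘ fun ω u ↦ sleDriving κ ω (s + u) - sleDriving κ ω s)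
      (T ∘ fun ω u ↦ sleDriving κ ω u) Process.preWienerMeasure Process.preWienerMeasure :=
    (identDistrib_sleDriving_shift κ s).symm.comp hTm
  have h1 : (T ∘ fun ω u ↦ sleDriving κ ω (s + u) - sleDriving κ ω s) =ᵐ[Process.preWienerMeasure]
      fun ω ↦ Loewner.trace (fun u ↦ sleDriving κ ω (s + u) - sleDriving κ ω s) := by
    filter_upwards [hs] with ω hω
    exact hT _ (((continuous_sleDriving κ ω).comp (continuous_const.add continuous_id)).sub
      continuous_const) hω
  have h2 : (T ∘ fun ω u ↦ sleDriving κ ω u) =ᵐ[Process.preWienerMeasure] fun ω ↦ sleTrace κ ω := by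
    filter_upwards [h0] with ω hω
    exact hT _ (continuous_sleDriving κ ω) hω
  exact (IdentDistrib.of_ae_eq (hTm.comp hmeas).aemeasurable h1).symm.trans
    (hlaw.trans (IdentDistrib.of_ae_eq (hTm.comp (measurable_sleDriving_pi κ)).aemeasurable h2))

/-- **The shifted trace is independent of the past.** Under the hypothesis `hs` (a.s. the chain
of the increments after `s` is generated by a curve), its trace is independent of
`(B t)_{t ≤ s}` (Mathlib `IsPreBrownianReal.indepFun_shift` composed with the measurable trace
functional, up to the a.s. identification). Rohde–Schramm (2005), Prop. 2.1 (ii); Lawler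
(2005), §6.2. [cite: RohdeSchramm2005, Prop. 2.1] -/
theorem indepFun_trace_shift {s : ℝ≥0}
    (hs : ∀ᵐ ω ∂Process.preWienerMeasure,
      ∃ γ, Loewner.IsGeneratedByCurve (fun u ↦ sleDriving κ ω (s + u) - sleDriving κ ω s) γ) :
    IndepFun (fun ω ↦ Loewner.trace (fun u ↦ sleDriving κ ω (s + u) - sleDriving κ ω s))
      (fun ω (t : Iic s) ↦ Process.brownian t ω) Process.preWienerMeasure := by
  obtain ⟨T, hTm, hT⟩ := Loewner.exists_measurable_eq_trace
  have hsc : Measurable fun (p : ℝ≥0 → ℝ) (u : ℝ≥0) ↦ Real.sqrt κ * p u :=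
    measurable_pi_lambda _ fun u ↦ (measurable_pi_apply u).const_mul _
  have hind := (isPreBrownianReal_brownian.indepFun_shift s).comp (hTm.comp hsc) measurable_id
  refine hind.congr ?_ EventuallyEq.rfl
  filter_upwards [hs] with ω hω
  have hfun : (fun u ↦ Real.sqrt κ * (Process.brownian (s + u) ω - Process.brownian s ω)) =
      fun u ↦ sleDriving κ ω (s + u) - sleDriving κ ω s :=
    funext fun u ↦ by simp only [sleDriving, mul_sub]
  simp only [Function.comp_apply, hfun]
  exact hT _ (((continuous_sleDriving κ ω).comp (continuous_const.add continuous_id)).sub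
    continuous_const) hω

/-- **The Markov decomposition of the SLE trace, almost surely along countably many times.**
If SLE_κ is a.s. generated by a curve and, for every `s` in a countable set `S`, a.s. the chain
of the increments after `s` is generated by a curve, then a.s., for all `s ∈ S` and all `u`,
`γ(s + u) = Fₛ(γˢ(u) + W(s))`, where `γ = sleTrace κ ω`, `γˢ` is the trace of
`u ↦ W(s + u) - W(s)` and `Fₛ` the continuous extension of `gₛ⁻¹` to the closed half-plane.
[cite: Lawler2005, §6.2] -/
theorem ae_sleTrace_add_eq_extendFrom (h0 : HasSLETrace κ) {S : Set ℝ≥0} (hS : S.Countable)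
    (hs : ∀ s ∈ S, ∀ᵐ ω ∂Process.preWienerMeasure,
      ∃ γ, Loewner.IsGeneratedByCurve (fun u ↦ sleDriving κ ω (s + u) - sleDriving κ ω s) γ) :
    ∀ᵐ ω ∂Process.preWienerMeasure, ∀ s ∈ S, ∀ u : ℝ≥0,
      sleTrace κ ω (s + u) = extendFrom upperHalfPlaneSet (Loewner.loewnerInv (sleDriving κ ω) s)
        (Loewner.trace (fun u ↦ sleDriving κ ω (s + u) - sleDriving κ ω s) u + sleDriving κ ω s) := by
  have hs' : ∀ᵐ ω ∂Process.preWienerMeasure, ∀ s ∈ S,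
      ∃ γ, Loewner.IsGeneratedByCurve (fun u ↦ sleDriving κ ω (s + u) - sleDriving κ ω s) γ :=
    (ae_ball_iff hS).2 hs
  filter_upwards [h0, hs'] with ω hω hωs s hsS u
  exact (Loewner.isGeneratedByCurve_trace hω).apply_add_eq_extendFrom (continuous_sleDriving κ ω)
    (Loewner.isGeneratedByCurve_trace (hωs s hsS)) u

/-! ### Unconditional forms for `κ ≠ 0, 8` from Cor. 3.5 -/

/-- **Law of the shifted SLE_κ trace, `κ ≠ 0, 8`, from Cor. 3.5** (`RohdeSchramm2005_cor35` on
the canonical space supplies both traces: `hasSLETrace_of_ne_eight_of_cor35`,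
`ae_exists_isGeneratedByCurve_shift_of_cor35`). [cite: RohdeSchramm2005, Prop. 2.1] -/
theorem identDistrib_trace_shift_of_cor35 (h : RohdeSchramm2005_cor35 Process.preWienerMeasure)
    (hκ : κ ≠ 0) (h8 : κ ≠ 8) (s : ℝ≥0) :
    IdentDistrib (fun ω ↦ Loewner.trace (fun u ↦ sleDriving κ ω (s + u) - sleDriving κ ω s))
      (fun ω ↦ sleTrace κ ω) Process.preWienerMeasure Process.preWienerMeasure :=
  identDistrib_trace_shift (hasSLETrace_of_ne_eight_of_cor35 h h8)
    (ae_exists_isGeneratedByCurve_shift_of_cor35 h hκ h8 s)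

/-- **Independence of the shifted SLE_κ trace from the past, `κ ≠ 0, 8`, from Cor. 3.5.**
[cite: RohdeSchramm2005, Prop. 2.1] -/
theorem indepFun_trace_shift_of_cor35 (h : RohdeSchramm2005_cor35 Process.preWienerMeasure)
    (hκ : κ ≠ 0) (h8 : κ ≠ 8) (s : ℝ≥0) :
    IndepFun (fun ω ↦ Loewner.trace (fun u ↦ sleDriving κ ω (s + u) - sleDriving κ ω s))
      (fun ω (t : Iic s) ↦ Process.brownian t ω) Process.preWienerMeasure :=
  indepFun_trace_shift (ae_exists_isGeneratedByCurve_shift_of_cor35 h hκ h8 s)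

/-- **The Markov decomposition of the SLE_κ trace along the rationals, `κ ≠ 0, 8`, from
Cor. 3.5**: a.s., for every rational `q` (as the time `(q : ℝ).toNNReal`) and every `u`,
`γ(q + u) = F_q(γ^q(u) + W(q))`. [cite: Lawler2005, §6.2] -/
theorem ae_sleTrace_add_eq_extendFrom_of_cor35 (h : RohdeSchramm2005_cor35 Process.preWienerMeasure)
    (hκ : κ ≠ 0) (h8 : κ ≠ 8) :
    ∀ᵐ ω ∂Process.preWienerMeasure, ∀ (q : ℚ) (u : ℝ≥0),
      sleTrace κ ω ((q : ℝ).toNNReal + u) =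
        extendFrom upperHalfPlaneSet (Loewner.loewnerInv (sleDriving κ ω) (q : ℝ).toNNReal)
          (Loewner.trace (fun u ↦ sleDriving κ ω ((q : ℝ).toNNReal + u) -
            sleDriving κ ω (q : ℝ).toNNReal) u + sleDriving κ ω (q : ℝ).toNNReal) := by
  have hS : (range fun q : ℚ ↦ (q : ℝ).toNNReal).Countable := countable_range _
  filter_upwards [ae_sleTrace_add_eq_extendFrom (hasSLETrace_of_ne_eight_of_cor35 h h8) hS
    fun s _ ↦ ae_exists_isGeneratedByCurve_shift_of_cor35 h hκ h8 s] with ω hω q u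
  exact hω _ ⟨q, rfl⟩ u

end Markov

end Literature.Probability.RandomPlanarGeometry
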